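import Literature.RingTheory.FormalGroups.FormalGroupHeightKernel
import Mathlib.RingTheory.PowerSeries.Inverse
import Mathlib.RingTheory.MvPowerSeries.Expand
import Mathlib.RingTheory.PowerSeries.NoZeroDivisors
import Mathlib.RingTheory.DiscreteValuationRing.Basic
import HarnessLib

/-!
# Frobenius kernels of a one-dimensional formal group law: `ker F^k = Spec A[X]⧸(X^{p^k})` is a subgroup scheme;
# ideals of `k⟦X⟧` are the `(X^n)`, one of each finite order (Harris–Taylor II.1–II.2 — proofs only)

Topic `Literature/RingTheory/FormalGroups`; namespace `Literature.RingTheory.FormalGroups`. THEOREMS ONLY (no definition,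
no named fact, no instance, no notation, no `sorry`). Cell `hodgecm-mathlib`, P6 «MOD programme», LEAD M-1 (G) HEART (b3)
(«a one-dimensional formal group over a field has EXACTLY ONE closed subgroup scheme of each order `p^m`, namely
`Spec k[X]⧸(X^{p^m})`») and the complement of ★ `FormalGroupHeightKernel.lean` (F0P3b-p01, `([π]_F) = (X^{q^h})`; its docstring:
«Deliberately NOT here: … Frobenius kernels of formal groups as group subschemes»):

* `span_X_pow_injective`, **`exists_unique_eq_span_X_pow`** — over a field `k` every nonzero ideal of `k⟦X⟧` is `(X^n)` for a
  UNIQUE `n` (Mathlib: `k⟦X⟧` is a DVR with uniformiser `X`): a one-dimensional formal group `Spf k⟦X⟧` has exactly one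
  closed subscheme `Spec k[X]⧸(X^n)` of each finite order `n`, hence AT MOST one closed subgroup scheme of each order;
  `FormalOModuleLaw.IsOfHeight.eq_pow_of_span_act_eq_span_X_pow` — the order of `ker [π]_F` is `q^h` (over ★
  `FormalOModuleLaw.span_act_eq_span_X_pow`).
* **`FormalGroup.pow_prime_pow_mem_span_X_pow`** — EXISTENCE: for ANY law `F` over an `𝔽_p`-algebra `A` and `k ≥ 0`,
  `F(X₀, X₁)^{p^k} ∈ (X₀^{p^k}, X₁^{p^k})`, i.e. the comultiplication `X ↦ F(X₀, X₁)` carries `(X^{p^k})` into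
  `(X₀^{p^k}, X₁^{p^k})`: `ker F^k = Spec A[X]⧸(X^{p^k})` IS a closed subGROUP scheme (from
  `F^{p^k} = F^{(p^k)}(X₀^{p^k}, X₁^{p^k})`, Mathlib `MvPowerSeries.map_iterateFrobenius_expand`).

## References
* [HarrisTaylorAMS2001] M. Harris, R. Taylor, *The geometry and cohomology of some simple Shimura varieties* (2001),
  §II.1 p. 59, §II.2.
-/

noncomputable section

namespace Literature.RingTheory.FormalGroups

universe u v

variable {A : Type u} [CommRing A]

/-! ## §1 Ideals of `k⟦X⟧`: exactly one of each finite colength -/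

/-- `n ↦ (X^n)` is injective on ideals of `A⟦X⟧` (`A` nontrivial). [cite: HarrisTaylorAMS2001, §II.2] -/
theorem span_X_pow_injective [Nontrivial A] :
    Function.Injective fun n : ℕ => Ideal.span {(PowerSeries.X : PowerSeries A) ^ n} := by
  -- `(X^n) = (X^m)` gives `X^m ∣ X^n` and `X^n ∣ X^m`; the coefficient of `X^n` in `X^n` is `1 ≠ 0`
  have key : ∀ {n m : ℕ}, (PowerSeries.X : PowerSeries A) ^ m ∣ PowerSeries.X ^ n → m ≤ n := by
    intro n m h
    by_contra hlt
    rw [PowerSeries.X_pow_dvd_iff] at h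
    have := h n (by omega)
    rw [PowerSeries.coeff_X_pow_self] at this
    exact one_ne_zero this
  intro n m h
  simp only at h
  have h1 : (PowerSeries.X : PowerSeries A) ^ m ∣ PowerSeries.X ^ n := by
    rw [← Ideal.mem_span_singleton, ← h]; exact Ideal.mem_span_singleton_self _
  have h2 : (PowerSeries.X : PowerSeries A) ^ n ∣ PowerSeries.X ^ m := by
    rw [← Ideal.mem_span_singleton, h]; exact Ideal.mem_span_singleton_self _
  exact le_antisymm (key h2) (key h1)

variable {k : Type u} [Field k]

/-- **Every nonzero ideal of `k⟦X⟧` is `(X^n)` for a unique `n`** (`k` a field; `k⟦X⟧` is a discrete valuation ring with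
uniformiser `X` — Mathlib `IsDiscreteValuationRing.ideal_eq_span_pow_irreducible`, `PowerSeries.X_irreducible`).  Hence a
one-dimensional formal group `Spf k⟦X⟧` over a field has EXACTLY ONE closed subscheme `Spec k[X]⧸(X^n)` of each finite
order `n`, and in particular at most one closed subgroup scheme of each order (Harris–Taylor II.2, the subgroups of
`Σ_{K,h}`). [cite: HarrisTaylorAMS2001, §II.2] -/
theorem exists_unique_eq_span_X_pow {I : Ideal (PowerSeries k)} (hI : I ≠ ⊥) :
    ∃! n : ℕ, I = Ideal.span {(PowerSeries.X : PowerSeries k) ^ n} := by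
  obtain ⟨n, hn⟩ := IsDiscreteValuationRing.ideal_eq_span_pow_irreducible hI PowerSeries.X_irreducible
  exact ⟨n, hn, fun m hm => span_X_pow_injective (hm.symm.trans hn)⟩

/-- The ideal `([π]_F)` of a formal `𝒪`-module law of height `h` over a FIELD is the unique ideal `(X^{q^h})`; any ideal
`J` with `J = (X^n)` and `J = ([π]_F)` has `n = q^h` (the ORDER of `ker [π]_F` is `q^h`). [cite: HarrisTaylorAMS2001, §II.1 p. 59] -/
theorem FormalOModuleLaw.IsOfHeight.eq_pow_of_span_act_eq_span_X_pow {𝒪 : Type v} [CommRing 𝒪] [Algebra 𝒪 k]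
    {M : FormalOModuleLaw 𝒪 k} {π : 𝒪} {q h : ℕ} (hM : M.IsOfHeight π q h) (hq : q ≠ 0) {n : ℕ}
    (hn : Ideal.span {(M.act π).toPowerSeries} = Ideal.span {(PowerSeries.X : PowerSeries k) ^ n}) :
    n = q ^ h :=
  span_X_pow_injective (hn.symm.trans (FormalOModuleLaw.span_act_eq_span_X_pow hM (pow_ne_zero h hq)))


/-! ## §2 `ker F^{p^k} = Spec A[X]⧸(X^{p^k})` IS a subgroup scheme of any formal group law in characteristic `p` -/

section Frobenius

open MvPowerSeries (X)

/-- A two-variable series without constant term lies in the ideal `(X₀, X₁)`: `G = X₀·G₀ + X₁·G₁`. [folklore] -/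
private theorem mem_span_X_of_constantCoeff_eq_zero (G : MvPowerSeries (Fin 2) A) (hG : G.constantCoeff = 0) :
    G ∈ Ideal.span {(X 0 : MvPowerSeries (Fin 2) A), X 1} := by
  classical
  -- the two partial quotients
  let G₀ : MvPowerSeries (Fin 2) A := fun d => MvPowerSeries.coeff (d + Finsupp.single 0 1) G
  let G₁ : MvPowerSeries (Fin 2) A := fun d =>
    if d 0 = 0 then MvPowerSeries.coeff (d + Finsupp.single 1 1) G else 0
  have hdec : G = X 0 * G₀ + X 1 * G₁ := by
    ext e
    rw [map_add, MvPowerSeries.X, MvPowerSeries.X, MvPowerSeries.coeff_monomial_mul,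
      MvPowerSeries.coeff_monomial_mul, one_mul, one_mul]
    simp only [Finsupp.single_le_iff]
    by_cases h0 : 1 ≤ e 0
    · rw [if_pos h0]
      have he : e - Finsupp.single 0 1 + Finsupp.single 0 1 = e :=
        tsub_add_cancel_of_le (Finsupp.single_le_iff.mpr h0)
      have h1' : ¬ ((e - Finsupp.single (1 : Fin 2) 1 : Fin 2 →₀ ℕ) (0 : Fin 2) = 0) := by
        rw [Finsupp.tsub_apply, Finsupp.single_apply, if_neg (by decide)]; omega
      change _ = MvPowerSeries.coeff (e - Finsupp.single 0 1 + Finsupp.single 0 1) G +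
        (if 1 ≤ e 1 then (if (e - Finsupp.single (1 : Fin 2) 1 : Fin 2 →₀ ℕ) (0 : Fin 2) = 0 then _ else 0) else 0)
      rw [he, if_neg h1', ite_self, add_zero]
    · rw [if_neg h0, zero_add]
      have he0 : e 0 = 0 := by omega
      by_cases h1 : 1 ≤ e 1
      · rw [if_pos h1]
        have he : e - Finsupp.single 1 1 + Finsupp.single 1 1 = e :=
          tsub_add_cancel_of_le (Finsupp.single_le_iff.mpr h1)
        have h0' : (e - Finsupp.single (1 : Fin 2) 1 : Fin 2 →₀ ℕ) (0 : Fin 2) = 0 := by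
          rw [Finsupp.tsub_apply, Finsupp.single_apply, if_neg (by decide), he0, tsub_zero]
        change _ = (if (e - Finsupp.single (1 : Fin 2) 1 : Fin 2 →₀ ℕ) (0 : Fin 2) = 0 then
          MvPowerSeries.coeff (e - Finsupp.single 1 1 + Finsupp.single 1 1) G else 0)
        rw [if_pos h0', he]
      · rw [if_neg h1]
        have he : e = 0 := by
          ext i; fin_cases i
          · exact he0
          · simpa using (by omega : e 1 = 0)
        rw [he, MvPowerSeries.coeff_zero_eq_constantCoeff, hG]
  rw [hdec]
  exact Ideal.add_mem _ (Ideal.mul_mem_right _ _ (Ideal.subset_span (by simp)))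
    (Ideal.mul_mem_right _ _ (Ideal.subset_span (by simp)))

/-- `G(X₀^m, X₁^m) ∈ (X₀^m, X₁^m)` for `G(0) = 0`. [folklore] -/
private theorem expand_mem_span_X_pow (G : MvPowerSeries (Fin 2) A) (hG : G.constantCoeff = 0) {m : ℕ}
    (hm : m ≠ 0) :
    MvPowerSeries.expand m hm G ∈ Ideal.span {(X 0 : MvPowerSeries (Fin 2) A) ^ m, X 1 ^ m} := by
  have h := Ideal.mem_map_of_mem (MvPowerSeries.expand m hm).toRingHom (mem_span_X_of_constantCoeff_eq_zero G hG)
  rw [Ideal.map_span] at h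
  simpa [Set.image_insert_eq, Set.image_singleton, MvPowerSeries.expand_X] using h

/-- **`ker F^k ⊂ G` is a subgroup scheme in characteristic `p`**: for ANY one-dimensional formal group law `F` over an
`𝔽_p`-algebra `A` and `k ≥ 0`, `F(X₀, X₁)^{p^k} ∈ (X₀^{p^k}, X₁^{p^k})` — the comultiplication `X ↦ F(X₀, X₁)` carries the
ideal `(X^{p^k})` into `(X₀^{p^k}, X₁^{p^k})`, so `Spec A[X]⧸(X^{p^k})` is a closed subGROUP scheme (the kernel of the
`k`-th relative Frobenius); from `F^{p^k} = F^{(p^k)}(X₀^{p^k}, X₁^{p^k})` (Mathlib `map_iterateFrobenius_expand`).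
Together with §1 («exactly one closed subscheme of each order»): over a field of characteristic `p` the closed subgroup
schemes of `Spf k⟦X⟧` of `p`-power order are exactly the `ker F^k`. [cite: HarrisTaylorAMS2001, §II.2] -/
theorem FormalGroup.pow_prime_pow_mem_span_X_pow (F : FormalGroup A) {p : ℕ} (hp : p.Prime) [CharP A p] (k : ℕ) :
    F.toPowerSeries ^ p ^ k ∈ Ideal.span {(X 0 : MvPowerSeries (Fin 2) A) ^ p ^ k, X 1 ^ p ^ k} := by
  haveI : Fact p.Prime := ⟨hp⟩
  haveI : ExpChar A p := ExpChar.prime hp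
  rw [← MvPowerSeries.map_iterateFrobenius_expand p hp.ne_zero F.toPowerSeries k]
  have h := Ideal.mem_map_of_mem (MvPowerSeries.map (iterateFrobenius A p k))
    (expand_mem_span_X_pow F.toPowerSeries F.zero_constantCoeff (pow_ne_zero k hp.ne_zero))
  rw [Ideal.map_span] at h
  simpa [Set.image_insert_eq, Set.image_singleton, MvPowerSeries.map_X] using h

end Frobenius

end Literature.RingTheory.FormalGroups
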